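import Summits.HubbardSuperconductivity.HubbardSuperconductivity.Theorems.EnslavedA1gTorusNormalForms
import Summits.HubbardSuperconductivity.HubbardSuperconductivity.Theorems.DeformationLadderLadderThesisPinnedFrameCovariance
import Literature.MathematicalPhysics.QuantumLattice.LiebSpinReflection
import HarnessLib

/-!
# Route `LiebTwin`, crux `DWavePolarisedDiscordance` (stmt-HubbardSuperconductivity-15314):
# Lieb transfer of `Δ_gᴴ Δ_g` for every even form factor (helper, `--supports`, stub `stub_evenPairFieldTransfer`)

First half of the KINEMATIC part of the card's identity calculus (I3)/(I4) (census `STRATEGY-CENSUS.md`,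
§Decomposition D1: "ConeIncrementIdentity + the Lieb transfer of `Δ_gᴴΔ_g` for `g ∈ {s, xs, d}` — provable now"):

* `pairField_eq_of_even` — for an EVEN form factor (`g(-e) = g(e)`; covers `sWave`, `extendedSWave`,
  `dWaveFormFactor`): `Δ_g = pairField g L = √2 Σ_x Σ_{e ∈ {0,±e₁,±e₂}} g(e) c_{x↑} c_{x+e,↓}` (the `↓↑` half of
  `localPair` is the `↑↓` half after `x ↦ x + e`, `e ↦ -e` and one anticommutation);
* `expect_pairField_eq_of_even` (= `stub_evenPairFieldTransfer`) — for `ψ` in the `(n, n)` sector,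
  `⟨ψ, Δ_gᴴ Δ_g ψ⟩ = Σ_{x,e,x',e'} 2 g(e) g(e') · Tr(W(ψ)ᴴ B_{xx'} W(ψ) B_{x+e,x'+e'}ᵀ)`, `B_{uv} = configHop n u v`
  (up hopping acts on Lieb's matrix `W` from the left, down hopping from the right; the on-site case is the
  tree's `expect_pairField_sWave_eq`);
* spectral coordinates for the sequel (`Theorems/LiebTwinDWavePolarisedDiscordanceChannelBound.lean`):
  `Tr(U_f M U_f M'ᴴ) = Σ_{a,b} f_a f_b N_{ab} conj N'_{ab}` for `U_f = V D_f Vᴴ`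
  (`trace_unitConj_mul_mul_unitConj_mul_conjTranspose`), the shifted Cauchy–Schwarz bound
  `|Σ u(x,x') conj u(σx,τx')| ≤ Σ |u|²` (`norm_sum_sum_mul_star_shift_le`), the termwise comparison of two
  rectification increments with coefficients `|f_a||f_b| - f_a f_b ≥ 0` (`abs_re_sum_sub_le`), and the
  form-factor bookkeeping `Σ_e |g(e)| = 1, 4` for `s`, extended-`s` (the `d` case is the tree's
  `PinnedFrame.sum_abs_dWaveFormFactor`).

Sources: E. H. Lieb, PRL **62** (1989) 1201, eqs. (3)–(4) and proof of Theorem 1; C. N. Yang, PRL **63** (1989)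
2144; D. J. Scalapino, Phys. Rep. **250** (1995) 329, §2, eqs. (2.2)–(2.3). Finite-dimensional bookkeeping; no
definition and no named fact is introduced.
-/

-- the mandated namespace `Summit.<Summit>.<Problem>.Theorems` repeats `HubbardSuperconductivity`
-- (single-problem summit, D-0017), which the `dupNamespace` linter flags on every declaration
set_option linter.dupNamespace false

noncomputable section

namespace Summit.HubbardSuperconductivity.HubbardSuperconductivity.Theorems.LiebTwinDiscordance

open Matrix Finset Literature.MathematicalPhysics.QuantumLattice Literature.Probability.LatticeModels
open Summit.HubbardSuperconductivity.EnslavedA1g (zero_notMem_unitSteps sum_unitSteps_neg)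
open scoped ComplexOrder MatrixOrder Matrix.Norms.L2Operator

/-! ### CAR reordering and the Lieb transfer of a product of two pair operators -/

section Transfer

variable {Λ : Type*} [LinearOrder Λ] [Fintype Λ]

/-- CAR reordering of one term of `Δ_gᴴ Δ_g`:
`(c_{x↑} c_{y↓})ᴴ (c_{x'↑} c_{y'↓}) = (c†_{x↑} c_{x'↑}) (c†_{y↓} c_{y'↓})` (two anticommutations of operators on
distinct orbitals). Yang, PRL 63 (1989) 2144; Scalapino, Phys. Rep. 250 (1995) 329, §2. [folklore] -/
theorem pair_conjTranspose_mul_pair₄ (x y x' y' : Λ) :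
    (annihilation (orb x 0) * annihilation (orb y 1) : Matrix (Finset (Orb Λ)) (Finset (Orb Λ)) ℂ)ᴴ *
        (annihilation (orb x' 0) * annihilation (orb y' 1)) =
      creation (orb x 0) * annihilation (orb x' 0) * (creation (orb y 1) * annihilation (orb y' 1)) := by
  rw [conjTranspose_mul]
  change creation (orb y 1) * creation (orb x 0) * (annihilation (orb x' 0) * annihilation (orb y' 1)) = _
  have h01 : (orb x' 0 : Orb Λ) ≠ orb y 1 := by
    rw [Ne, orb_inj]
    exact fun h => absurd h.2 (by decide)
  have hac : creation (orb y 1) * annihilation (orb x' 0) =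
      -(annihilation (orb x' 0) * creation (orb y 1) : Matrix (Finset (Orb Λ)) (Finset (Orb Λ)) ℂ) := by
    rw [annihilation_mul_creation, if_neg h01, zero_sub, neg_neg]
  calc creation (orb y 1) * creation (orb x 0) * (annihilation (orb x' 0) * annihilation (orb y' 1))
      = -(creation (orb x 0) * (creation (orb y 1) * annihilation (orb x' 0)) * annihilation (orb y' 1)) := by
        rw [creation_mul_creation_eq_neg (orb y 1) (orb x 0)]
        simp only [neg_mul, Matrix.mul_assoc]
    _ = creation (orb x 0) * annihilation (orb x' 0) * (creation (orb y 1) * annihilation (orb y' 1)) := by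
        rw [hac]
        simp only [mul_neg, neg_mul, neg_neg, Matrix.mul_assoc]

/-- **Lieb transfer of a hopping pair.** For `ψ` in the `(n, n)` sector,
`⟨ψ, (c†_{x↑} c_{x'↑})(c†_{y↓} c_{y'↓}) ψ⟩ = Tr(W(ψ)ᴴ B_{xx'} W(ψ) B_{yy'}ᵀ)`, `B_{uv} = configHop n u v` (up hopping
acts on `W` from the left, down hopping from the right by the transpose; `ψ ↦ W` is unitary on the sector).
Lieb, PRL 62 (1989) 1201, eqs. (3)–(4). [folklore] -/
theorem star_dotProduct_hopPair_mulVec {n : ℕ} {ψ : Fock (Orb Λ)} (hψ : IsInSector n n ψ)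
    (x x' y y' : Λ) :
    star ψ ⬝ᵥ ((creation (orb x 0) * annihilation (orb x' 0) *
        (creation (orb y 1) * annihilation (orb y' 1))) *ᵥ ψ) =
      ((liebW n ψ)ᴴ * (configHop n x x' * (liebW n ψ * (configHop n y y')ᵀ))).trace := by
  rw [← LiebThm1.hsInner_liebW hψ, hsInner, ← mulVec_mulVec, LiebThm1.liebW_hopping_up_mulVec,
    LiebThm1.liebW_hopping_down_mulVec]

end Transfer

/-! ### The pair field of an even form factor in normal form, and its transfer -/

section Torus

variable (L : ℕ) [NeZero L]

/-- `2 · (r/√2) = √2 · r`. [folklore] -/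
theorem two_mul_div_sqrt_two (r : ℝ) : 2 * (r / Real.sqrt 2) = Real.sqrt 2 * r := by
  have hs : Real.sqrt 2 * Real.sqrt 2 = 2 := Real.mul_self_sqrt (by norm_num)
  have hne : Real.sqrt 2 ≠ 0 := by positivity
  calc 2 * (r / Real.sqrt 2) = Real.sqrt 2 * Real.sqrt 2 * (r / Real.sqrt 2) := by rw [hs]
    _ = Real.sqrt 2 * (Real.sqrt 2 * (r / Real.sqrt 2)) := by ring
    _ = Real.sqrt 2 * r := by rw [mul_div_assoc', mul_div_cancel_left₀ r hne]

/-- **Normal form of the pair field of an EVEN form factor** (`g(-e) = g(e)`):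
`Δ_g = pairField g L = √2 Σ_x Σ_{e ∈ {0,±e₁,±e₂}} g(e) c_{x↑} c_{x+e,↓}` — the `↓↑` half of `localPair` is the
`↑↓` half after `x ↦ x + e`, `e ↦ -e` and one anticommutation (this covers `sWave`, `extendedSWave`,
`dWaveFormFactor`). Scalapino, Phys. Rep. 250 (1995) 329, §2, eqs. (2.2)–(2.3). [folklore] -/
theorem pairField_eq_of_even (g : Site 2 → ℝ) (hg : ∀ e, g (-e) = g e) :
    pairField g L = ∑ x : TorusSite 2 L, ∑ e ∈ insert (0 : Site 2) unitSteps,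
      ((Real.sqrt 2 * g e : ℝ) : ℂ) •
        (annihilation (orb (FermionTorus.ofTorusSite x) 0) *
          annihilation (orb (FermionTorus.ofTorusSite (x + Torus.proj L e)) 1)) := by
  set A : TorusSite 2 L → Site 2 → Matrix (Finset (Orb (FermionTorus 2 L))) (Finset (Orb (FermionTorus 2 L))) ℂ :=
    fun x e => annihilation (orb (FermionTorus.ofTorusSite x) 0) *
      annihilation (orb (FermionTorus.ofTorusSite (x + Torus.proj L e)) 1) with hA
  set B : TorusSite 2 L → Site 2 → Matrix (Finset (Orb (FermionTorus 2 L))) (Finset (Orb (FermionTorus 2 L))) ℂ :=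
    fun x e => annihilation (orb (FermionTorus.ofTorusSite x) 1) *
      annihilation (orb (FermionTorus.ofTorusSite (x + Torus.proj L e)) 0) with hB
  have hstep : pairField g L = ∑ x : TorusSite 2 L, ∑ e ∈ insert (0 : Site 2) unitSteps,
      ((g e / Real.sqrt 2 : ℝ) : ℂ) • (A x e - B x e) := by
    unfold pairField localPair
    rfl
  have hBA : ∑ x : TorusSite 2 L, ∑ e ∈ insert (0 : Site 2) unitSteps, ((g e / Real.sqrt 2 : ℝ) : ℂ) • B x e =
      -∑ x : TorusSite 2 L, ∑ e ∈ insert (0 : Site 2) unitSteps, ((g e / Real.sqrt 2 : ℝ) : ℂ) • A x e := by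
    rw [Finset.sum_comm]
    conv_rhs => rw [Finset.sum_comm, ← Finset.sum_neg_distrib, ← PinnedFrame.sum_insert_unitSteps_comp_neg]
    refine Finset.sum_congr rfl fun e _ => ?_
    rw [← Finset.sum_neg_distrib, hg]
    refine Fintype.sum_equiv (Equiv.addRight (Torus.proj L e)) _ _ fun x => ?_
    simp only [hA, hB, Equiv.coe_addRight, Torus.proj_neg, add_neg_cancel_right, ← smul_neg]
    congr 1
    exact LiebThm1.annihilation_mul_annihilation_eq_neg _ _
  rw [hstep]
  simp only [smul_sub, Finset.sum_sub_distrib]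
  rw [hBA, sub_neg_eq_add, ← Finset.sum_add_distrib]
  refine Finset.sum_congr rfl fun x _ => ?_
  rw [← Finset.sum_add_distrib]
  refine Finset.sum_congr rfl fun e _ => ?_
  rw [← add_smul, ← two_mul, ← Complex.ofReal_ofNat, ← Complex.ofReal_mul, two_mul_div_sqrt_two]

/-- **The pair order of an even form factor in Lieb coordinates.** For every `(n, n)`-sector `ψ` on the
torus and every even `g`:
`⟨ψ, Δ_gᴴ Δ_g ψ⟩ = Σ_{x,e} Σ_{x',e'} 2 g(e) g(e') · Tr(W(ψ)ᴴ B_{x x'} W(ψ) B_{x+e, x'+e'}ᵀ)`, `B_{uv} = configHop n u v`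
(the on-site case `g = sWave` is the tree's `expect_pairField_sWave_eq`). Lieb, PRL 62 (1989) 1201, eqs. (3)–(4);
Scalapino, Phys. Rep. 250 (1995) 329, §2. [folklore] -/
theorem expect_pairField_eq_of_even (g : Site 2 → ℝ) (hg : ∀ e, g (-e) = g e) {n : ℕ}
    {ψ : Fock (Orb (FermionTorus 2 L))} (hψ : IsInSector n n ψ) :
    expect ((pairField g L)ᴴ * pairField g L) ψ =
      ∑ x : TorusSite 2 L, ∑ e ∈ insert (0 : Site 2) unitSteps,
        ∑ x' : TorusSite 2 L, ∑ e' ∈ insert (0 : Site 2) unitSteps,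
          ((2 * (g e * g e') : ℝ) : ℂ) *
            ((liebW n ψ)ᴴ * (configHop n (FermionTorus.ofTorusSite x) (FermionTorus.ofTorusSite x') *
              (liebW n ψ * (configHop n (FermionTorus.ofTorusSite (x + Torus.proj L e))
                (FermionTorus.ofTorusSite (x' + Torus.proj L e')))ᵀ))).trace := by
  rw [Literature.MathematicalPhysics.QuantumLattice.expect, pairField_eq_of_even L g hg, conjTranspose_sum, Finset.sum_mul, Matrix.sum_mulVec,
    dotProduct_sum]
  refine Finset.sum_congr rfl fun x _ => ?_
  rw [conjTranspose_sum, Finset.sum_mul, Matrix.sum_mulVec, dotProduct_sum]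
  refine Finset.sum_congr rfl fun e _ => ?_
  rw [Finset.mul_sum, Matrix.sum_mulVec, dotProduct_sum]
  refine Finset.sum_congr rfl fun x' _ => ?_
  rw [Finset.mul_sum, Matrix.sum_mulVec, dotProduct_sum]
  refine Finset.sum_congr rfl fun e' _ => ?_
  rw [conjTranspose_smul, smul_mul_assoc, mul_smul_comm, smul_smul, Matrix.smul_mulVec,
    dotProduct_smul, pair_conjTranspose_mul_pair₄, star_dotProduct_hopPair_mulVec hψ, smul_eq_mul]
  congr 1
  rw [Complex.star_def, Complex.conj_ofReal, ← Complex.ofReal_mul]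
  congr 1
  have hs : Real.sqrt 2 * Real.sqrt 2 = 2 := Real.mul_self_sqrt (by norm_num)
  calc Real.sqrt 2 * g e * (Real.sqrt 2 * g e') = Real.sqrt 2 * Real.sqrt 2 * (g e * g e') := by ring
    _ = 2 * (g e * g e') := by rw [hs]

end Torus

/-! ### Spectral coordinates: `Tr(U_f M U_f M'ᴴ)` for `U_f = V D_f Vᴴ` -/

section Spectral

variable {A : Type*} [Fintype A] [DecidableEq A]

omit [DecidableEq A] in
/-- Entries of `Vᴴ Mᴴ V` are the conjugates of the transposed entries of `Vᴴ M V`. [folklore] -/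
theorem conjBasis_conjTranspose_apply (V M : Matrix A A ℂ) (a b : A) :
    (Vᴴ * Mᴴ * V) b a = star ((Vᴴ * M * V) a b) := by
  have h : (Vᴴ * M * V)ᴴ = Vᴴ * Mᴴ * V := by
    rw [conjTranspose_mul, conjTranspose_mul, conjTranspose_conjTranspose, Matrix.mul_assoc]
  rw [← h, conjTranspose_apply]

/-- **Spectral expansion** ("in this diagonal basis I compute"): for `U_f = V D_f Vᴴ` and any `M, M'`,
`Tr(U_f M U_f M'ᴴ) = Σ_{a,b} f_a f_b N_{ab} conj(N'_{ab})`, `N = Vᴴ M V`, `N' = Vᴴ M' V`.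
Lieb, PRL 62 (1989) 1201, proof of Theorem 1. [folklore] -/
theorem trace_unitConj_mul_mul_unitConj_mul_conjTranspose (V : Matrix A A ℂ) (f : A → ℝ)
    (M M' : Matrix A A ℂ) :
    (unitConj V f * M * unitConj V f * M'ᴴ).trace =
      ∑ a, ∑ b, (f a : ℂ) * (f b : ℂ) * ((Vᴴ * M * V) a b * star ((Vᴴ * M' * V) a b)) := by
  rw [trace_unitConj_mul_mul, trace_diagonal_mul_mul_diagonal_mul]
  refine Finset.sum_congr rfl fun a _ => Finset.sum_congr rfl fun b _ => ?_
  rw [conjBasis_conjTranspose_apply]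
  ring

/-- Moving a double sum out of a fourfold sum (bookkeeping). [folklore] -/
theorem sum_sum_sum_sum_comm₂ {α β γ M : Type*} [Fintype α] [Fintype γ] [AddCommMonoid M]
    (S : Finset β) (F : α → β → α → β → γ → γ → M) :
    ∑ x, ∑ e ∈ S, ∑ x', ∑ e' ∈ S, ∑ a, ∑ b, F x e x' e' a b =
      ∑ a, ∑ b, ∑ x, ∑ e ∈ S, ∑ x', ∑ e' ∈ S, F x e x' e' a b := by
  have h1 : ∀ x e x', ∑ e' ∈ S, ∑ a, ∑ b, F x e x' e' a b = ∑ a, ∑ b, ∑ e' ∈ S, F x e x' e' a b := by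
    intro x e x'
    rw [Finset.sum_comm]
    refine Finset.sum_congr rfl fun a _ => ?_
    rw [Finset.sum_comm]
  have h2 : ∀ x e, ∑ x', ∑ e' ∈ S, ∑ a, ∑ b, F x e x' e' a b =
      ∑ a, ∑ b, ∑ x', ∑ e' ∈ S, F x e x' e' a b := by
    intro x e
    simp_rw [h1]
    rw [Finset.sum_comm]
    refine Finset.sum_congr rfl fun a _ => ?_
    rw [Finset.sum_comm]
  have h3 : ∀ x, ∑ e ∈ S, ∑ x', ∑ e' ∈ S, ∑ a, ∑ b, F x e x' e' a b =
      ∑ a, ∑ b, ∑ e ∈ S, ∑ x', ∑ e' ∈ S, F x e x' e' a b := by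
    intro x
    simp_rw [h2]
    rw [Finset.sum_comm]
    refine Finset.sum_congr rfl fun a _ => ?_
    rw [Finset.sum_comm]
  simp_rw [h3]
  rw [Finset.sum_comm]
  refine Finset.sum_congr rfl fun a _ => ?_
  rw [Finset.sum_comm]

/-- **Shifted Cauchy–Schwarz.** `|Σ_{x,x'} u(x,x') conj(u(σx, τx'))| ≤ Σ_{x,x'} |u(x,x')|²` for bijections
`σ, τ` (termwise `|ab| ≤ (|a|² + |b|²)/2` and reindexing of the second half). [folklore] -/
theorem norm_sum_sum_mul_star_shift_le {T : Type*} [Fintype T] (σ τ : T ≃ T) (u : T → T → ℂ) :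
    ‖∑ x, ∑ x', u x x' * star (u (σ x) (τ x'))‖ ≤ ∑ x, ∑ x', ‖u x x'‖ ^ 2 := by
  have hshift : ∑ x, ∑ x', ‖u (σ x) (τ x')‖ ^ 2 = ∑ x, ∑ x', ‖u x x'‖ ^ 2 := by
    calc ∑ x, ∑ x', ‖u (σ x) (τ x')‖ ^ 2 = ∑ x, ∑ x', ‖u (σ x) x'‖ ^ 2 :=
          Finset.sum_congr rfl fun x _ => Equiv.sum_comp τ (fun x' => ‖u (σ x) x'‖ ^ 2)
      _ = ∑ x, ∑ x', ‖u x x'‖ ^ 2 := Equiv.sum_comp σ (fun x => ∑ x', ‖u x x'‖ ^ 2)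
  calc ‖∑ x, ∑ x', u x x' * star (u (σ x) (τ x'))‖
      ≤ ∑ x, ‖∑ x', u x x' * star (u (σ x) (τ x'))‖ := norm_sum_le _ _
    _ ≤ ∑ x, ∑ x', ‖u x x' * star (u (σ x) (τ x'))‖ :=
        Finset.sum_le_sum fun x _ => norm_sum_le _ _
    _ = ∑ x, ∑ x', ‖u x x'‖ * ‖u (σ x) (τ x')‖ := by simp_rw [norm_mul, norm_star]
    _ ≤ ∑ x, ∑ x', (‖u x x'‖ ^ 2 / 2 + ‖u (σ x) (τ x')‖ ^ 2 / 2) :=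
        Finset.sum_le_sum fun x _ => Finset.sum_le_sum fun x' _ => by
          nlinarith [sq_nonneg (‖u x x'‖ - ‖u (σ x) (τ x')‖)]
    _ = (∑ x, ∑ x', ‖u x x'‖ ^ 2) / 2 + (∑ x, ∑ x', ‖u (σ x) (τ x')‖ ^ 2) / 2 := by
        simp_rw [Finset.sum_add_distrib, Finset.sum_div]
    _ = ∑ x, ∑ x', ‖u x x'‖ ^ 2 := by rw [hshift]; ring

omit [DecidableEq A] in
/-- **Termwise comparison of two rectification increments.** If `|Y^g_{ab}| ≤ C·Re Y^s_{ab}` for all `a, b`,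
then for every real vector `f`:
`|Re Σ f_a f_b Y^g_{ab} - Re Σ |f_a||f_b| Y^g_{ab}| ≤ C·(Re Σ |f_a||f_b| Y^s_{ab} - Re Σ f_a f_b Y^s_{ab})`
(the coefficients `|f_a||f_b| - f_a f_b` are nonnegative). Lieb, PRL 62 (1989) 1201, proof of Theorem 1
(the step `w_i w_j ≤ |w_i||w_j|`). [folklore] -/
theorem abs_re_sum_sub_le (f : A → ℝ) (Yg Ys : A → A → ℂ) (C : ℝ)
    (hY : ∀ a b, ‖Yg a b‖ ≤ C * (Ys a b).re) :
    |(∑ a, ∑ b, (f a : ℂ) * (f b : ℂ) * Yg a b).re - (∑ a, ∑ b, ((|f a| : ℝ) : ℂ) * ((|f b| : ℝ) : ℂ) * Yg a b).re| ≤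
      C * ((∑ a, ∑ b, ((|f a| : ℝ) : ℂ) * ((|f b| : ℝ) : ℂ) * Ys a b).re -
        (∑ a, ∑ b, (f a : ℂ) * (f b : ℂ) * Ys a b).re) := by
  have hcoef : ∀ a b, 0 ≤ |f a| * |f b| - f a * f b := fun a b => by
    rw [← abs_mul]; exact sub_nonneg.2 (le_abs_self _)
  have hre : ∀ (r s : ℝ) (z : ℂ), ((r : ℂ) * (s : ℂ) * z).re = r * s * z.re := by
    intro r s z
    rw [← Complex.ofReal_mul, Complex.re_ofReal_mul]
  have key : ∀ a b,
      |((f a : ℂ) * (f b : ℂ) * Yg a b).re - (((|f a| : ℝ) : ℂ) * ((|f b| : ℝ) : ℂ) * Yg a b).re| ≤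
        C * ((((|f a| : ℝ) : ℂ) * ((|f b| : ℝ) : ℂ) * Ys a b).re - ((f a : ℂ) * (f b : ℂ) * Ys a b).re) := by
    intro a b
    rw [hre, hre, hre, hre,
      show f a * f b * (Yg a b).re - |f a| * |f b| * (Yg a b).re =
        -((|f a| * |f b| - f a * f b) * (Yg a b).re) by ring,
      abs_neg, abs_mul, abs_of_nonneg (hcoef a b),
      show C * (|f a| * |f b| * (Ys a b).re - f a * f b * (Ys a b).re) =
        (|f a| * |f b| - f a * f b) * (C * (Ys a b).re) by ring]
    exact mul_le_mul_of_nonneg_left ((Complex.abs_re_le_norm _).trans (hY a b)) (hcoef a b)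
  -- sum the termwise bounds
  have hL : (∑ a, ∑ b, (f a : ℂ) * (f b : ℂ) * Yg a b).re - (∑ a, ∑ b, ((|f a| : ℝ) : ℂ) * ((|f b| : ℝ) : ℂ) * Yg a b).re =
      ∑ a, ∑ b, (((f a : ℂ) * (f b : ℂ) * Yg a b).re - (((|f a| : ℝ) : ℂ) * ((|f b| : ℝ) : ℂ) * Yg a b).re) := by
    simp_rw [Complex.re_sum, ← Finset.sum_sub_distrib]
  have hR : C * ((∑ a, ∑ b, ((|f a| : ℝ) : ℂ) * ((|f b| : ℝ) : ℂ) * Ys a b).re -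
        (∑ a, ∑ b, (f a : ℂ) * (f b : ℂ) * Ys a b).re) =
      ∑ a, ∑ b, C * (((((|f a| : ℝ) : ℂ) * ((|f b| : ℝ) : ℂ) * Ys a b).re - ((f a : ℂ) * (f b : ℂ) * Ys a b).re)) := by
    simp_rw [Complex.re_sum, ← Finset.sum_sub_distrib, Finset.mul_sum]
  rw [hL, hR]
  refine (Finset.abs_sum_le_sum_abs _ _).trans (Finset.sum_le_sum fun a _ => ?_)
  exact (Finset.abs_sum_le_sum_abs _ _).trans (Finset.sum_le_sum fun b _ => key a b)

end Spectral

/-! ### Form factors: evenness and `Σ_e |g(e)|` -/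

section FormFactors

/-- `-e` is a unit step iff `e` is. [folklore] -/
theorem neg_mem_unitSteps_iff (e : Site 2) : -e ∈ unitSteps ↔ e ∈ unitSteps := by
  simp only [unitSteps, Finset.mem_insert, Finset.mem_singleton, neg_eq_iff_eq_neg, neg_neg]
  tauto

/-- The extended-`s` form factor is even. Scalapino, Phys. Rep. 250 (1995) 329, §2. [folklore] -/
theorem extendedSWave_even (e : Site 2) : extendedSWave (-e) = extendedSWave e := by
  simp only [extendedSWave, neg_mem_unitSteps_iff]

/-- A sum over the steps `{0, ±e₁, ±e₂}`, term by term. [folklore] -/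
theorem sum_insert_unitSteps_eq (F : Site 2 → ℝ) :
    ∑ e ∈ insert (0 : Site 2) unitSteps, F e =
      F 0 + (F (Pi.single 0 1) + (F (-Pi.single 0 1) + (F (Pi.single 1 1) + F (-Pi.single 1 1)))) := by
  rw [Finset.sum_insert zero_notMem_unitSteps, unitSteps, Finset.sum_insert (by decide),
    Finset.sum_insert (by decide), Finset.sum_insert (by decide), Finset.sum_singleton]

/-- `Σ_{e ∈ {0,±e₁,±e₂}} |sWave e| = 1`. [folklore] -/
theorem sum_abs_sWave : ∑ e ∈ insert (0 : Site 2) unitSteps, |sWave e| = 1 := by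
  rw [sum_insert_unitSteps_eq]
  have h1 : (Pi.single 0 1 : Site 2) ≠ 0 := by decide
  have h2 : (-Pi.single 0 1 : Site 2) ≠ 0 := by decide
  have h3 : (Pi.single 1 1 : Site 2) ≠ 0 := by decide
  have h4 : (-Pi.single 1 1 : Site 2) ≠ 0 := by decide
  simp [sWave, h1, h2, h3, h4]

/-- `Σ_{e ∈ {0,±e₁,±e₂}} |extendedSWave e| = 4`. [folklore] -/
theorem sum_abs_extendedSWave : ∑ e ∈ insert (0 : Site 2) unitSteps, |extendedSWave e| = 4 := by
  rw [sum_insert_unitSteps_eq]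
  have h0 : extendedSWave 0 = 0 := if_neg zero_notMem_unitSteps
  have h1 : extendedSWave (Pi.single 0 1) = 1 := if_pos (by simp [unitSteps])
  have h2 : extendedSWave (-Pi.single 0 1) = 1 := if_pos (by simp [unitSteps])
  have h3 : extendedSWave (Pi.single 1 1) = 1 := if_pos (by simp [unitSteps])
  have h4 : extendedSWave (-Pi.single 1 1) = 1 := if_pos (by simp [unitSteps])
  rw [h0, h1, h2, h3, h4]
  norm_num

end FormFactors

/-! ### The registered stub (route vocabulary) -/

/-- **STUB `stub_evenPairFieldTransfer`** of crux `DWavePolarisedDiscordance` (stmt-HubbardSuperconductivity-15314):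
the Lieb transfer of `Δ_gᴴ Δ_g` for every even form factor `g` and every `(n, n)`-sector vector of the torus,
`⟨ψ, Δ_gᴴ Δ_g ψ⟩ = Σ_{x,e,x',e'} 2 g(e) g(e') Tr(Wᴴ B_{xx'} W B_{x+e,x'+e'}ᵀ)`. Lieb, PRL 62 (1989) 1201, eqs. (3)–(4);
Scalapino, Phys. Rep. 250 (1995) 329, §2. [folklore] -/
theorem stub_evenPairFieldTransfer :
    open Literature.MathematicalPhysics.QuantumLattice Literature.Probability.LatticeModels in
    ∀ (L : ℕ) [NeZero L] (g : Site 2 → ℝ), (∀ e, g (-e) = g e) →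
      ∀ (n : ℕ) (ψ : Fock (Orb (FermionTorus 2 L))), IsInSector n n ψ →
        expect ((pairField g L)ᴴ * pairField g L) ψ =
          ∑ x : TorusSite 2 L, ∑ e ∈ insert (0 : Site 2) unitSteps,
            ∑ x' : TorusSite 2 L, ∑ e' ∈ insert (0 : Site 2) unitSteps,
              ((2 * (g e * g e') : ℝ) : ℂ) *
                ((liebW n ψ)ᴴ * (configHop n (FermionTorus.ofTorusSite x) (FermionTorus.ofTorusSite x') *
                  (liebW n ψ * (configHop n (FermionTorus.ofTorusSite (x + Torus.proj L e))
                    (FermionTorus.ofTorusSite (x' + Torus.proj L e')))ᵀ))).trace :=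
  fun L _ g hg _ _ hψ => expect_pairField_eq_of_even L g hg hψ

end Summit.HubbardSuperconductivity.HubbardSuperconductivity.Theorems.LiebTwinDiscordance

end
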